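import Mathlib
import Summits.ResolutionOfSingularities.ResolutionOfSingularities.Theorems.WeightedInvariantLocalWeightedDropNCResSurfGraphIdeal
import Summits.ResolutionOfSingularities.ResolutionOfSingularities.Theorems.WeightedInvariantLocalWeightedDropTOT2BridgeDecorated
import Literature.NumberTheory.EllipticCurves.FormalGroupLaw

/-!
# `WeightedInvariant.LocalWeightedDrop`: NC-resolution settings for the TOT₂ line — GRAPH SURFACES, part 4: the ENTRY
# «a permissible smooth formal surface through the point is a GRAPH over two of the letters» (the surface twin of the LC bridge)

Crux item stmt-ResolutionOfSingularities-8899 `LocalWeightedDrop` (route `ResolutionOfSingularities/WeightedInvariant`), ENGINE skeleton v32, residuals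
`stub_spaceNCRankDrop` / `stub_wildWideApexFourStartsWon` (res-L1-w43-strat-1's line `directrix-cut` v3.1, piece PL = `ApexPlaneExit`, SURFACE sub-case;
design memo `L/res-L1-w43-stub-4/g5/S-E2-SURF.md`).  [OURS · L1 W4.3 · chain w43 · seat res-L1-w43-stub-4 gen 5; one bookkeeping definition
(`planeEmb`, the restriction to a coordinate plane); the two-variable twin of res-type-056's `…NCResCurveGraphEntry` (p-id in the tree), whose
substitution-algebra proof is transposed here; the count game is the programme's own; nothing here is a statement of any manuscript; AI-produced,
gate-checked, weaker than expert review.]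

WHAT.  The hypothesis of the SURFACE sub-case of `ApexPlaneExit` is «there is a LEGAL coordinate change `Φ` and two slots `a' ≠ b'` with
`Φ^* g ∈ (x_j : j ∉ {a',b'})^c`» (`GraphSurf.InOffPlaneIdeal a' b' c (Φ^* g)`), i.e. the germ `g` of order `c` is equimultiple along the smooth formal
surface `S = Φ̂(V(x_j : j ∉ {a',b'}))`.  The S-E2-SURF loop runs on GRAPH presentations `S = {x_j = ψ_j(x_a, x_b)}`.  THE BRIDGE
(`exists_shear_inOffPlaneIdeal_of_legal`): such a `Φ` yields base letters `a ≠ b` and a graph datum `ψ` (`ψ_j(0) = 0`, `ψ_a = u₁`, `ψ_b = u₂`) with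
`InOffPlaneIdeal a b c (shear_{a,b}(ψ)^* g)`.
PROOF (substitution algebra; the one place linear algebra enters is the choice of the base): `γ_l(u) := Φ_l(u₁ e_{a'} + u₂ e_{b'})` parametrises
`S`; its linear part consists of the columns `a', b'` of the linear part of `Φ`, which has a non-vanishing `2 × 2` minor at some rows `a ≠ b`
(`exists_minor_ne_zero_of_isUnit_det`: two columns of an invertible matrix are not proportional); so `η := (γ_a, γ_b)` is a legal two-variable
coordinate change with a two-sided inverse `θ` (`exists_legal_inverse`), and `ψ_l := γ_l ∘ θ` has `ψ_a = u₁`, `ψ_b = u₂`.  With `Ψ` the two-sided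
inverse of `Φ` and `S := shear_{a,b}(ψ)`: `S^* g = Λ^*(Φ^* g)` for `Λ_j := S^* Ψ_j`, and the restriction of `Λ_j` to the base plane is
`Ψ_j(Φ(θ(u)·(e_{a'}, e_{b'}))) = (θ(u)·(e_{a'}, e_{b'}))_j = 0` for `j ∉ {a',b'}` — so `Λ_j ∈ (x_l : l ∉ {a,b})` (`inOffPlaneIdeal_one_of_restrict_eq_zero`,
from the coefficient formula `coeff_subst_planeEmb`), and part 2's transport `InOffPlaneIdeal.subst` carries the permissibility over.
-/

set_option linter.dupNamespace false -- mandated namespace of this single-conjunct summit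

noncomputable section

namespace Summit.ResolutionOfSingularities.ResolutionOfSingularities.Theorems

namespace TameFourTupleDrop

namespace GraphSurf

open MvPowerSeries Literature.AlgebraicGeometry.Resolution

variable {k : Type} [Field k] {m : ℕ}

/-! ## Restriction to a coordinate plane -/

/-- The PLANE EMBEDDING `x_a ↦ u₁`, `x_b ↦ u₂`, `x_l ↦ 0` (`l ∉ {a,b}`): substituting it restricts a germ to the coordinate plane spanned by
`x_a, x_b`. [OURS] -/
def planeEmb (a b : Fin (m + 1)) : Fin (m + 1) → MvPowerSeries (Fin 2) k :=
  fun l => if l = a then X 0 else if l = b then X 1 else 0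

/-- Values of the plane embedding. -/
theorem planeEmb_left (a b : Fin (m + 1)) : planeEmb (k := k) a b a = X 0 := by simp [planeEmb]

/-- Values of the plane embedding. -/
theorem planeEmb_right {a b : Fin (m + 1)} (hab : a ≠ b) : planeEmb (k := k) a b b = X 1 := by simp [planeEmb, hab.symm]

/-- Values of the plane embedding. -/
theorem planeEmb_of_ne {a b l : Fin (m + 1)} (hl : ¬ (l = a ∨ l = b)) : planeEmb (k := k) a b l = 0 := by
  simp [planeEmb, not_or.mp hl]

/-- The plane embedding has zero constant terms. -/
theorem constantCoeff_planeEmb (a b l : Fin (m + 1)) : constantCoeff (planeEmb (k := k) a b l) = 0 := by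
  simp only [planeEmb]
  split_ifs
  · exact constantCoeff_X _
  · exact constantCoeff_X _
  · exact map_zero _

/-- The plane embedding may be substituted. -/
theorem hasSubst_planeEmb (a b : Fin (m + 1)) : HasSubst (planeEmb (k := k) a b) :=
  hasSubst_of_constantCoeff_zero (constantCoeff_planeEmb a b)

/-- An exponent with off-base degree `0` is supported on the base letters. -/
theorem eq_single_add_single_of_offDeg₂_eq_zero {a b : Fin (m + 1)} (hab : a ≠ b) {E : Fin (m + 1) →₀ ℕ} (h : offDeg₂ a b E = 0) :
    E = Finsupp.single a (E a) + Finsupp.single b (E b) := by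
  ext j
  by_cases hj : j = a ∨ j = b
  · rcases hj with rfl | rfl
    · rw [Finsupp.add_apply, Finsupp.single_eq_same, Finsupp.single_eq_of_ne hab, add_zero]
    · rw [Finsupp.add_apply, Finsupp.single_eq_same, Finsupp.single_eq_of_ne (Ne.symm hab), zero_add]
  · rw [Finsupp.add_apply, Finsupp.single_eq_of_ne (fun h' => hj (Or.inl h')), Finsupp.single_eq_of_ne (fun h' => hj (Or.inr h')),
      add_zero]
    rw [offDeg₂] at h
    exact (Finset.sum_eq_zero_iff.mp h) j (mem_offBase_iff.mpr hj)

/-- **THE PLANE RESTRICTION READS THE MONOMIALS ON THE BASE LETTERS**: the coefficient of `u₁^p u₂^q` in `G(…, u₁, …, u₂, …, 0, …)` is the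
coefficient of `x_a^p x_b^q` in `G`. -/
theorem coeff_subst_planeEmb {a b : Fin (m + 1)} (hab : a ≠ b) (G : MvPowerSeries (Fin (m + 1)) k) (n : Fin 2 →₀ ℕ) :
    coeff n (subst (planeEmb a b) G) = coeff (Finsupp.single a (n 0) + Finsupp.single b (n 1)) G := by
  classical
  rw [coeff_subst (hasSubst_planeEmb a b)]
  set d₀ : Fin (m + 1) →₀ ℕ := Finsupp.single a (n 0) + Finsupp.single b (n 1) with hd₀
  have hd₀a : d₀ a = n 0 := by rw [hd₀, Finsupp.add_apply, Finsupp.single_eq_same, Finsupp.single_eq_of_ne hab, add_zero]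
  have hd₀b : d₀ b = n 1 := by rw [hd₀, Finsupp.add_apply, Finsupp.single_eq_same, Finsupp.single_eq_of_ne (Ne.symm hab), zero_add]
  have hprod : ∀ d : Fin (m + 1) →₀ ℕ, coeff n (d.prod fun s e => (planeEmb (k := k) a b s) ^ e) = if d = d₀ then 1 else 0 := by
    intro d
    by_cases hsupp : offDeg₂ a b d = 0
    · -- supported on the base: the product is `u₁^{d a} u₂^{d b}`
      have hsub : d.support ⊆ ({a, b} : Finset (Fin (m + 1))) := by
        intro s hs
        rw [Finset.mem_insert, Finset.mem_singleton]
        by_contra hsn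
        have h0 : d s = 0 := by
          rw [offDeg₂] at hsupp
          exact (Finset.sum_eq_zero_iff.mp hsupp) s (mem_offBase_iff.mpr hsn)
        exact (Finsupp.mem_support_iff.mp hs) h0
      rw [Finsupp.prod_of_support_subset d hsub _ (fun i _ => pow_zero _), Finset.prod_pair hab, planeEmb_left, planeEmb_right hab,
        X_pow_eq, X_pow_eq, monomial_mul_monomial, one_mul, coeff_monomial]
      have hiff : n = Finsupp.single 0 (d a) + Finsupp.single 1 (d b) ↔ d = d₀ := by
        constructor
        · intro hn
          rw [eq_single_add_single_of_offDeg₂_eq_zero hab hsupp, hd₀, hn]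
          simp
        · intro hd
          rw [Literature.NumberTheory.EllipticCurves.finsupp_fin_two_eq n, hd, hd₀a, hd₀b]
      by_cases hn : n = Finsupp.single 0 (d a) + Finsupp.single 1 (d b)
      · rw [if_pos hn, if_pos (hiff.mp hn)]
      · rw [if_neg hn, if_neg (fun h => hn (hiff.mpr h))]
    · -- another letter occurs: the product vanishes
      obtain ⟨s, hs, hs0⟩ : ∃ s, s ∈ (Finset.univ.erase a).erase b ∧ d s ≠ 0 := by
        by_contra hne
        push Not at hne
        exact hsupp (Finset.sum_eq_zero fun s hs => hne s hs)
      have hsab : ¬ (s = a ∨ s = b) := mem_offBase_iff.mp hs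
      rw [Finsupp.prod, ← Finset.mul_prod_erase _ _ (Finsupp.mem_support_iff.mpr hs0), planeEmb_of_ne hsab, zero_pow hs0, zero_mul,
        map_zero, if_neg]
      rintro rfl
      rw [hd₀, Finsupp.add_apply, Finsupp.single_eq_of_ne (fun h' => hsab (Or.inl h')),
        Finsupp.single_eq_of_ne (fun h' => hsab (Or.inr h')), add_zero] at hs0
      exact hs0 rfl
  rw [finsum_eq_single _ d₀ (fun d hd => by rw [hprod d, if_neg hd, smul_zero]), hprod, if_pos rfl, smul_eq_mul, mul_one]

/-- Linear coefficients of the plane restriction: `∂_{u₁}` reads `∂_{x_a}`. -/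
theorem coeff_single_zero_subst_planeEmb {a b : Fin (m + 1)} (hab : a ≠ b) (G : MvPowerSeries (Fin (m + 1)) k) :
    coeff (Finsupp.single 0 1) (subst (planeEmb a b) G) = coeff (Finsupp.single a 1) G := by
  rw [coeff_subst_planeEmb hab, Finsupp.single_eq_same, Finsupp.single_eq_of_ne (by decide : (1 : Fin 2) ≠ 0), Finsupp.single_zero,
    add_zero]

/-- Linear coefficients of the plane restriction: `∂_{u₂}` reads `∂_{x_b}`. -/
theorem coeff_single_one_subst_planeEmb {a b : Fin (m + 1)} (hab : a ≠ b) (G : MvPowerSeries (Fin (m + 1)) k) :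
    coeff (Finsupp.single 1 1) (subst (planeEmb a b) G) = coeff (Finsupp.single b 1) G := by
  rw [coeff_subst_planeEmb hab, Finsupp.single_eq_same, Finsupp.single_eq_of_ne (by decide : (0 : Fin 2) ≠ 1), Finsupp.single_zero,
    zero_add]

/-- A germ whose restriction to the base plane vanishes lies in the ideal of the other letters: `InOffPlaneIdeal a b 1`. -/
theorem inOffPlaneIdeal_one_of_restrict_eq_zero {a b : Fin (m + 1)} (hab : a ≠ b) {G : MvPowerSeries (Fin (m + 1)) k}
    (h : subst (planeEmb (k := k) a b) G = 0) : InOffPlaneIdeal a b 1 G := by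
  intro E hE
  by_contra hlt
  have h0 : offDeg₂ a b E = 0 := by omega
  have hE' := eq_single_add_single_of_offDeg₂_eq_zero hab h0
  have hc := coeff_subst_planeEmb hab G (Finsupp.single 0 (E a) + Finsupp.single 1 (E b))
  rw [h, map_zero, Finsupp.add_apply, Finsupp.add_apply, Finsupp.single_eq_same, Finsupp.single_eq_same,
    Finsupp.single_eq_of_ne (by decide : (1 : Fin 2) ≠ 0), Finsupp.single_eq_of_ne (by decide : (0 : Fin 2) ≠ 1), add_zero, zero_add,
    ← hE'] at hc
  exact hE hc.symm

/-- The identity substitution on two letters, spelled `![X 0, X 1]`. -/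
theorem subst_vecCons_X (F : MvPowerSeries (Fin 2) k) :
    subst ![(X 0 : MvPowerSeries (Fin 2) k), (X 1 : MvPowerSeries (Fin 2) k)] F = F := by
  have h : (![(X 0 : MvPowerSeries (Fin 2) k), (X 1 : MvPowerSeries (Fin 2) k)] : Fin 2 → MvPowerSeries (Fin 2) k) = X := by
    funext t
    fin_cases t <;> rfl
  rw [h, subst_self]
  rfl

/-! ## Two columns of an invertible matrix have a non-vanishing `2 × 2` minor -/

/-- **TWO DISTINCT COLUMNS OF AN INVERTIBLE MATRIX ARE NOT PROPORTIONAL**: some `2 × 2` minor on them is non-zero. -/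
theorem exists_minor_ne_zero_of_isUnit_det {n : ℕ} {M : Matrix (Fin n) (Fin n) k} (hM : IsUnit M.det) {a' b' : Fin n} (hab' : a' ≠ b') :
    ∃ a b : Fin n, a ≠ b ∧ M a a' * M b b' - M a b' * M b a' ≠ 0 := by
  by_contra H
  push Not at H
  -- the column `a'` is non-zero
  obtain ⟨a, ha⟩ : ∃ a, M a a' ≠ 0 := by
    by_contra h
    push Not at h
    exact hM.ne_zero (Matrix.det_eq_zero_of_column_eq_zero a' h)
  -- hence the column `b'` is a multiple of it
  set c : k := M a b' / M a a' with hc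
  have hcol : ∀ r, M r b' = c * M r a' := by
    intro r
    by_cases hr : r = a
    · rw [hr, hc, div_mul_cancel₀ _ ha]
    · have h := H a r (Ne.symm hr)
      rw [sub_eq_zero] at h
      rw [hc, div_mul_eq_mul_div, eq_div_iff ha, mul_comm (M r b'), h, mul_comm]
  by_cases hc0 : c = 0
  · -- the column `b'` vanishes
    exact hM.ne_zero (Matrix.det_eq_zero_of_column_eq_zero b' fun r => by rw [hcol r, hc0, zero_mul])
  · -- scale the column `a'` by `c`: two equal columns
    have hupd : M.updateCol a' (c • fun r => M r a') = M.updateCol a' (fun r => M r b') := by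
      congr 1
      funext r
      rw [Pi.smul_apply, smul_eq_mul, hcol r]
    have hdet : (M.updateCol a' (fun r => M r b')).det = 0 :=
      Matrix.det_zero_of_column_eq hab' fun r => by
        rw [Matrix.updateCol_self, Matrix.updateCol_ne (Ne.symm hab')]
    have hself : M.updateCol a' (fun r => M r a') = M := by
      ext r s
      by_cases hs : s = a'
      · rw [hs, Matrix.updateCol_self]
      · rw [Matrix.updateCol_ne hs]
    have h := Matrix.det_updateCol_smul M a' c (fun r => M r a')
    rw [hupd, hdet, hself] at h
    exact hM.ne_zero ((mul_eq_zero.mp h.symm).resolve_left hc0)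

/-! ## The bridge -/

/-- **THE SURFACE ENTRY BRIDGE, GRAPH FORM.**  A legal `Φ` (zero constant terms, invertible linear part) and two slots `a' ≠ b'` with
`Φ^* g ∈ (x_j : j ∉ {a',b'})^c` yield base letters `a ≠ b` and a graph datum `ψ` (`ψ_j(0) = 0`, `ψ_a = u₁`, `ψ_b = u₂`) such that the base plane is
permissible at order `c` for `shear_{a,b}(ψ)^* g` (`InOffPlaneIdeal a b c`): the surface `Φ̂(V(x_j : j ∉ {a',b'}))` is the graph
`{x_j = ψ_j(x_a, x_b)}`.  See the module docstring for the proof. -/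
theorem exists_shear_inOffPlaneIdeal_of_legal {Φ : Fin (m + 1) → MvPowerSeries (Fin (m + 1)) k}
    (hΦ0 : ∀ l, constantCoeff (Φ l) = 0)
    (hΦdet : IsUnit (Matrix.det (Matrix.of fun i j : Fin (m + 1) => coeff (Finsupp.single j 1) (Φ i))))
    {a' b' : Fin (m + 1)} (hab' : a' ≠ b') {c : ℕ} {g : MvPowerSeries (Fin (m + 1)) k} (hin : InOffPlaneIdeal a' b' c (subst Φ g)) :
    ∃ (a b : Fin (m + 1)) (ψ : Fin (m + 1) → MvPowerSeries (Fin 2) k), a ≠ b ∧ (∀ j, constantCoeff (ψ j) = 0) ∧ ψ a = X 0 ∧ ψ b = X 1 ∧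
      InOffPlaneIdeal a b c (subst (shear a b ψ) g) := by
  classical
  have hΦs : HasSubst Φ := hasSubst_of_constantCoeff_zero hΦ0
  -- the two-sided legal inverse of `Φ`
  obtain ⟨Ψ, hΨ0, -, hΨΦ, hΦΨ, -⟩ := exists_legal_inverse hΦ0 hΦdet
  have hΨs : HasSubst Ψ := hasSubst_of_constantCoeff_zero hΨ0
  -- the surface parametrised over the base plane of `Φ`'s coordinates: `γ_l(u) = Φ_l(u₁ e_{a'} + u₂ e_{b'})`
  have hAs : HasSubst (planeEmb (k := k) a' b') := hasSubst_planeEmb a' b'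
  set γ : Fin (m + 1) → MvPowerSeries (Fin 2) k := fun l => subst (planeEmb a' b') (Φ l) with hγ
  have hγ0 : ∀ l, constantCoeff (γ l) = 0 := fun l => constantCoeff_subst_eq_zero hAs (constantCoeff_planeEmb a' b') (hΦ0 l)
  have hγ1 : ∀ l, coeff (Finsupp.single 0 1) (γ l) = coeff (Finsupp.single a' 1) (Φ l) := fun l => coeff_single_zero_subst_planeEmb hab' (Φ l)
  have hγ2 : ∀ l, coeff (Finsupp.single 1 1) (γ l) = coeff (Finsupp.single b' 1) (Φ l) := fun l => coeff_single_one_subst_planeEmb hab' (Φ l)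
  -- a non-vanishing `2 × 2` minor of the columns `a', b'`: the base rows `a ≠ b`
  obtain ⟨a, b, hab, hminor⟩ := exists_minor_ne_zero_of_isUnit_det hΦdet hab'
  simp only [Matrix.of_apply] at hminor
  -- the legal two-variable map `η = (γ_a, γ_b)` and its two-sided inverse `θ`
  set η : Fin 2 → MvPowerSeries (Fin 2) k := ![γ a, γ b] with hη
  have hη0 : ∀ t, constantCoeff (η t) = 0 := fun t => by fin_cases t <;> simp [hη, hγ0]
  have hηdet : IsUnit (FormalCoordChange.linMat η).det := by
    rw [FormalCoordChange.linMat, Matrix.det_fin_two]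
    simp only [Matrix.of_apply, hη, Matrix.cons_val_zero, Matrix.cons_val_one, hγ1, hγ2]
    exact (Ne.isUnit hminor)
  obtain ⟨θ, hθ0, -, hθη, -, -⟩ := exists_legal_inverse hη0 hηdet
  have hθs : HasSubst θ := hasSubst_of_constantCoeff_zero hθ0
  have hηs : HasSubst η := hasSubst_of_constantCoeff_zero hη0
  -- the graph datum `ψ_l := γ_l ∘ θ`
  set ψ : Fin (m + 1) → MvPowerSeries (Fin 2) k := fun l => subst θ (γ l) with hψ
  have hψ0 : ∀ j, constantCoeff (ψ j) = 0 := fun j => constantCoeff_subst_eq_zero hθs hθ0 (hγ0 j)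
  have hψa : ψ a = X 0 := by
    have h := hθη (X 0)
    rwa [subst_X hηs, show η 0 = γ a from rfl] at h
  have hψb : ψ b = X 1 := by
    have h := hθη (X 1)
    rwa [subst_X hηs, show η 1 = γ b from rfl] at h
  -- `ψ_l = Φ_l(B)` with `B = θ ∘ planeEmb`
  set B : Fin (m + 1) → MvPowerSeries (Fin 2) k := fun l => subst θ (planeEmb (k := k) a' b' l) with hB
  have hB0 : ∀ l, constantCoeff (B l) = 0 := fun l => constantCoeff_subst_eq_zero hθs hθ0 (constantCoeff_planeEmb a' b' l)
  have hBs : HasSubst B := hasSubst_of_constantCoeff_zero hB0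
  have hBof : ∀ l, ¬ (l = a' ∨ l = b') → B l = 0 := fun l hl => by
    simp only [hB, planeEmb_of_ne (k := k) hl]
    rw [← coe_substAlgHom hθs, map_zero]
  have hψB : ∀ l, ψ l = subst B (Φ l) := fun l => by
    simp only [hψ, hγ]
    rw [subst_comp_subst_apply hAs hθs]
  -- the graph shear and the transported family `Λ_j := S^* Ψ_j`
  have hψ0' : ∀ j, ¬ (j = a ∨ j = b) → constantCoeff (ψ j) = 0 := fun j _ => hψ0 j
  have hSs : HasSubst (shear a b ψ) := hasSubst_shear hψ0'
  set Λ : Fin (m + 1) → MvPowerSeries (Fin (m + 1)) k := fun j => subst (shear a b ψ) (Ψ j) with hΛ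
  have hΛ0 : ∀ j, constantCoeff (Λ j) = 0 := fun j => constantCoeff_subst_eq_zero hSs (constantCoeff_shear hψ0') (hΨ0 j)
  have hΛs : HasSubst Λ := hasSubst_of_constantCoeff_zero hΛ0
  have hSg : subst (shear a b ψ) g = subst Λ (subst Φ g) := by
    conv_lhs => rw [← hΨΦ g]
    rw [subst_comp_subst_apply hΨs hSs]
  -- the restriction of `Λ_j` to the base plane is `Ψ_j(Φ(B)) = B_j`
  have hAi : HasSubst (planeEmb (k := k) a b) := hasSubst_planeEmb a b
  have hAiS : ∀ l, subst (planeEmb a b) (shear a b ψ l) = ψ l := fun l => by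
    by_cases hl : l = a ∨ l = b
    · rw [shear_of_base hl, subst_X hAi]
      rcases hl with rfl | rfl
      · rw [planeEmb_left, hψa]
      · rw [planeEmb_right hab, hψb]
    · rw [shear_of_ne hl, subst_add hAi, subst_X hAi, planeEmb_of_ne hl, zero_add, subst_onPlane _ hAi, planeEmb_left,
        planeEmb_right hab, subst_vecCons_X]
  have hAiΛ : ∀ j, subst (planeEmb a b) (Λ j) = B j := fun j => by
    simp only [hΛ]
    rw [subst_comp_subst_apply hSs hAi, show (fun l => subst (planeEmb a b) (shear a b ψ l)) = fun l => subst B (Φ l) from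
      funext fun l => (hAiS l).trans (hψB l), ← subst_comp_subst_apply hΦs hBs, ← subst_X (R := k) hΨs j, hΦΨ, subst_X hBs]
  have hoff : ∀ j, ¬ (j = a' ∨ j = b') → InOffPlaneIdeal a b 1 (Λ j) := fun j hj =>
    inOffPlaneIdeal_one_of_restrict_eq_zero hab (by rw [hAiΛ j, hBof j hj])
  -- transport the permissibility
  refine ⟨a, b, ψ, hab, hψ0, hψa, hψb, ?_⟩
  rw [hSg]
  exact hin.subst Λ hΛs hoff

/-- **THE SURFACE ENTRY BRIDGE** for the line `directrix-cut` (PL sub-case «the `c`-fold locus is a smooth surface»): from «∃ legal `Φ`, ∃ `a' ≠ b'`,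
`Φ^* g ∈ (x_j : j ∉ {a',b'})^c`» to a GRAPH presentation over two letters with the permissibility of the base plane — the entry of the S-E2-SURF
loop, whose terminal step is part 1's `dWinsTo_headDrop_of_terminal`. -/
theorem exists_graph_of_legal_inOffPlaneIdeal {g : MvPowerSeries (Fin (m + 1)) k} {c : ℕ}
    (h : ∃ (Φ : Fin (m + 1) → MvPowerSeries (Fin (m + 1)) k) (a' b' : Fin (m + 1)), (∀ l, constantCoeff (Φ l) = 0) ∧
      IsUnit (Matrix.det (Matrix.of fun i j : Fin (m + 1) => coeff (Finsupp.single j 1) (Φ i))) ∧ a' ≠ b' ∧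
      InOffPlaneIdeal a' b' c (subst Φ g)) :
    ∃ (a b : Fin (m + 1)) (ψ : Fin (m + 1) → MvPowerSeries (Fin 2) k), a ≠ b ∧ (∀ j, constantCoeff (ψ j) = 0) ∧ ψ a = X 0 ∧ ψ b = X 1 ∧
      InOffPlaneIdeal a b c (subst (shear a b ψ) g) := by
  obtain ⟨Φ, a', b', hΦ0, hΦdet, hab', hin⟩ := h
  exact exists_shear_inOffPlaneIdeal_of_legal hΦ0 hΦdet hab' hin

end GraphSurf

end TameFourTupleDrop

end Summit.ResolutionOfSingularities.ResolutionOfSingularities.Theorems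

end
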